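import Summits.MatrixMultiplication.MatrixMultiplication.Theorems.SoloInformedValHubPairFaces

/-!
# Mixed images of two complete blocks: the face inequalities need no hub

Solo-informed MatrixMultiplication, gen 81 (dossier `paper/val-superlinear.md` §15.8 (n)(iv), (viii)); a sequel to
`SoloInformedValHubPairFaces`.

Two complete blocks `X₁ × Y₁ × Z₁`, `X₂ × Y₂ × Z₂` (identity potentials in an abelian group `G`, pair graphs
`blockPairs`) with `Y₁ ∩ Y₂ = ∅ = Z₁ ∩ Z₂`; the row classes `X₁, X₂` are ARBITRARY (disjoint, sharing a hub, or
overlapping in several rows).  For `a, b, c ∈ {1, 2}` write `M_abc = {x + y - z : x ∈ X_a, y ∈ Y_b, z ∈ Z_c}`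
(`mixedImage`) and `M'_abc = {y - z - x : …}` (`mixedImageNeg`).  If the union of the two blocks is accidental-free
then

* `M_111`, `M_122`, `M_212` are pairwise disjoint (`NoAccidental.disjoint_mixedImage_*`), and
* `M'_111`, `M'_122`, `M'_221` are pairwise disjoint (`NoAccidental.disjoint_mixedImageNeg_*`):

a coincidence between two of them is literally an accidental solution `(x - y') + (y - z) + (z' - x') = 0` whose
three edges lie in the blocks indicated by the indices, and `NoAccidental` then forces two `J`-vertices (or two
`K`-vertices) of different blocks to coincide.  (Among the eight mixed images these two triples and their images
under the block swap are exactly the families forced to be pairwise disjoint.)  Consequently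
(`NoAccidental.card_mixedImages_le`, `NoAccidental.card_mixedImagesNeg_le`)

  `|X₁ + Y₁ - Z₁| + |X₁ + Y₂ - Z₂| + |X₂ + Y₁ - Z₂| ≤ |G|`,
  `|Y₁ - Z₁ - X₁| + |Y₂ - Z₂ - X₁| + |Y₂ - Z₁ - X₂| ≤ |G|`,

and since `|X₁ + Y₁ - Z₁| = |X₁||Y₁||Z₁|` (block 1 is a TPP block), `|X₁ + Y₂ - Z₂| ≥ |Y₂||Z₂|`,
`|X₂ + Y₁ - Z₂| ≥ |X₂||Z₂|`, `|Y₂ - Z₁ - X₂| ≥ |X₂||Y₂|` (block 2 is a TPP block), the two HUB FACE INEQUALITIES of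
`SoloInformedValHubPairFaces`

  `|X₁||Y₁||Z₁| + |Y₂||Z₂| + |X₂||Z₂| ≤ |G|`,   `|X₁||Y₁||Z₁| + |Y₂||Z₂| + |X₂||Y₂| ≤ |G|`

hold WITHOUT any common row (`NoAccidental.volume_add_faces_YZ_XZ_le_of_disjoint`,
`NoAccidental.volume_add_faces_YZ_XY_le_of_disjoint`; only non-emptiness of the classes is assumed).  The refined
(image) form is the one relevant to the open three-row case of the conjectured bound `v₁ + v₂ ≤ |G|`: it bounds the
collisions `|X₁ + Y₂ - Z₂| - |Y₂||Z₂|` of the translates of `Y₂ - Z₂` by the rows of the OTHER block.  No `sorry`.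
-/

namespace Summit.MatrixMultiplication.MatrixMultiplication.Theorems.SoloVal

open Finset

section MixedImages

variable {G : Type*} [AddCommGroup G] [DecidableEq G]
variable {X₁ Y₁ Z₁ X₂ Y₂ Z₂ : Finset G}

/-- The mixed image `{x + y - z : x ∈ X, y ∈ Y, z ∈ Z}`. -/
def mixedImage (X Y Z : Finset G) : Finset G :=
  (X ×ˢ Y ×ˢ Z).image (fun t => t.1 + t.2.1 - t.2.2)

/-- The mirrored mixed image `{y - z - x : x ∈ X, y ∈ Y, z ∈ Z}`. -/
def mixedImageNeg (X Y Z : Finset G) : Finset G :=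
  (X ×ˢ Y ×ˢ Z).image (fun t => t.2.1 - t.2.2 - t.1)

/-- Membership in a mixed image. -/
theorem mem_mixedImage {X Y Z : Finset G} {g : G} :
    g ∈ mixedImage X Y Z ↔ ∃ x ∈ X, ∃ y ∈ Y, ∃ z ∈ Z, x + y - z = g := by
  unfold mixedImage
  constructor
  · intro hg
    obtain ⟨⟨x, y, z⟩, hm, h⟩ := Finset.mem_image.mp hg
    simp only [Finset.mem_product] at hm
    exact ⟨x, hm.1, y, hm.2.1, z, hm.2.2, h⟩
  · rintro ⟨x, hx, y, hy, z, hz, h⟩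
    exact Finset.mem_image.mpr ⟨(x, y, z), by simp only [Finset.mem_product]; exact ⟨hx, hy, hz⟩, h⟩

/-- Membership in a mirrored mixed image. -/
theorem mem_mixedImageNeg {X Y Z : Finset G} {g : G} :
    g ∈ mixedImageNeg X Y Z ↔ ∃ x ∈ X, ∃ y ∈ Y, ∃ z ∈ Z, y - z - x = g := by
  unfold mixedImageNeg
  constructor
  · intro hg
    obtain ⟨⟨x, y, z⟩, hm, h⟩ := Finset.mem_image.mp hg
    simp only [Finset.mem_product] at hm
    exact ⟨x, hm.1, y, hm.2.1, z, hm.2.2, h⟩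
  · rintro ⟨x, hx, y, hy, z, hz, h⟩
    exact Finset.mem_image.mpr ⟨(x, y, z), by simp only [Finset.mem_product]; exact ⟨hx, hy, hz⟩, h⟩

/-- `M_111 ∩ M_122 = ∅`: a coincidence `x + y₁ - z₁ = x' + y₂ - z₂` is the accidental solution
`(x' - y₁) + (y₂ - z₂) + (z₁ - x) = 0` and would force `y₁ = y₂`. -/
theorem NoAccidental.disjoint_mixedImage_111_122 (hY : Disjoint Y₁ Y₂)
    (hN : NoAccidental (id : G → G) id id (blockPairs X₁ Y₁ X₂ Y₂) (blockPairs Y₁ Z₁ Y₂ Z₂)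
      (blockPairs Z₁ X₁ Z₂ X₂)) :
    Disjoint (mixedImage X₁ Y₁ Z₁) (mixedImage X₁ Y₂ Z₂) := by
  rw [Finset.disjoint_left]
  intro g hg1 hg2
  obtain ⟨x, hx, y₁, hy₁, z₁, hz₁, rfl⟩ := mem_mixedImage.mp hg1
  obtain ⟨x', hx', y₂, hy₂, z₂, hz₂, heq⟩ := mem_mixedImage.mp hg2
  have h0 : (x' - y₁) + (y₂ - z₂) + (z₁ - x) = 0 :=
    calc (x' - y₁) + (y₂ - z₂) + (z₁ - x) = (x' + y₂ - z₂) - (x + y₁ - z₁) := by abel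
      _ = 0 := by rw [heq, sub_self]
  have hc := hN x' y₁ y₂ z₂ z₁ x (mem_blockPairs.mpr (Or.inl ⟨hx', hy₁⟩))
    (mem_blockPairs.mpr (Or.inr ⟨hy₂, hz₂⟩)) (mem_blockPairs.mpr (Or.inl ⟨hz₁, hx⟩)) h0
  exact Finset.disjoint_left.mp hY hy₁ (hc.2.1 ▸ hy₂)

/-- `M_111 ∩ M_212 = ∅`: a coincidence `x + y₁ - z₁ = w + y₁' - z₂` is the accidental solution
`(x - y₁') + (y₁ - z₁) + (z₂ - w) = 0` and would force `z₁ = z₂`. -/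
theorem NoAccidental.disjoint_mixedImage_111_212 (hZ : Disjoint Z₁ Z₂)
    (hN : NoAccidental (id : G → G) id id (blockPairs X₁ Y₁ X₂ Y₂) (blockPairs Y₁ Z₁ Y₂ Z₂)
      (blockPairs Z₁ X₁ Z₂ X₂)) :
    Disjoint (mixedImage X₁ Y₁ Z₁) (mixedImage X₂ Y₁ Z₂) := by
  rw [Finset.disjoint_left]
  intro g hg1 hg2
  obtain ⟨x, hx, y₁, hy₁, z₁, hz₁, rfl⟩ := mem_mixedImage.mp hg1
  obtain ⟨w, hw, y₁', hy₁', z₂, hz₂, heq⟩ := mem_mixedImage.mp hg2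
  have h0 : (x - y₁') + (y₁ - z₁) + (z₂ - w) = 0 :=
    calc (x - y₁') + (y₁ - z₁) + (z₂ - w) = (x + y₁ - z₁) - (w + y₁' - z₂) := by abel
      _ = 0 := by rw [heq, sub_self]
  have hc := hN x y₁' y₁ z₁ z₂ w (mem_blockPairs.mpr (Or.inl ⟨hx, hy₁'⟩))
    (mem_blockPairs.mpr (Or.inl ⟨hy₁, hz₁⟩)) (mem_blockPairs.mpr (Or.inr ⟨hz₂, hw⟩)) h0
  exact Finset.disjoint_left.mp hZ hz₁ (hc.2.2.symm ▸ hz₂)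

/-- `M_122 ∩ M_212 = ∅`: a coincidence `x + y₂ - z₂ = w + y₁ - z₂'` is the accidental solution
`(x - y₁) + (y₂ - z₂) + (z₂' - w) = 0` and would force `y₁ = y₂`. -/
theorem NoAccidental.disjoint_mixedImage_122_212 (hY : Disjoint Y₁ Y₂)
    (hN : NoAccidental (id : G → G) id id (blockPairs X₁ Y₁ X₂ Y₂) (blockPairs Y₁ Z₁ Y₂ Z₂)
      (blockPairs Z₁ X₁ Z₂ X₂)) :
    Disjoint (mixedImage X₁ Y₂ Z₂) (mixedImage X₂ Y₁ Z₂) := by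
  rw [Finset.disjoint_left]
  intro g hg1 hg2
  obtain ⟨x, hx, y₂, hy₂, z₂, hz₂, rfl⟩ := mem_mixedImage.mp hg1
  obtain ⟨w, hw, y₁, hy₁, z₂', hz₂', heq⟩ := mem_mixedImage.mp hg2
  have h0 : (x - y₁) + (y₂ - z₂) + (z₂' - w) = 0 :=
    calc (x - y₁) + (y₂ - z₂) + (z₂' - w) = (x + y₂ - z₂) - (w + y₁ - z₂') := by abel
      _ = 0 := by rw [heq, sub_self]
  have hc := hN x y₁ y₂ z₂ z₂' w (mem_blockPairs.mpr (Or.inl ⟨hx, hy₁⟩))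
    (mem_blockPairs.mpr (Or.inr ⟨hy₂, hz₂⟩)) (mem_blockPairs.mpr (Or.inr ⟨hz₂', hw⟩)) h0
  exact Finset.disjoint_left.mp hY hy₁ (hc.2.1 ▸ hy₂)

/-- `M'_111 ∩ M'_122 = ∅` (mirror): `y₁ - z₁ - x = y₂ - z₂ - x'` is the accidental solution
`(x - y₁) + (y₂ - z₂) + (z₁ - x') = 0` and would force `y₁ = y₂`. -/
theorem NoAccidental.disjoint_mixedImageNeg_111_122 (hY : Disjoint Y₁ Y₂)
    (hN : NoAccidental (id : G → G) id id (blockPairs X₁ Y₁ X₂ Y₂) (blockPairs Y₁ Z₁ Y₂ Z₂)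
      (blockPairs Z₁ X₁ Z₂ X₂)) :
    Disjoint (mixedImageNeg X₁ Y₁ Z₁) (mixedImageNeg X₁ Y₂ Z₂) := by
  rw [Finset.disjoint_left]
  intro g hg1 hg2
  obtain ⟨x, hx, y₁, hy₁, z₁, hz₁, rfl⟩ := mem_mixedImageNeg.mp hg1
  obtain ⟨x', hx', y₂, hy₂, z₂, hz₂, heq⟩ := mem_mixedImageNeg.mp hg2
  have h0 : (x - y₁) + (y₂ - z₂) + (z₁ - x') = 0 :=
    calc (x - y₁) + (y₂ - z₂) + (z₁ - x') = (y₂ - z₂ - x') - (y₁ - z₁ - x) := by abel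
      _ = 0 := by rw [heq, sub_self]
  have hc := hN x y₁ y₂ z₂ z₁ x' (mem_blockPairs.mpr (Or.inl ⟨hx, hy₁⟩))
    (mem_blockPairs.mpr (Or.inr ⟨hy₂, hz₂⟩)) (mem_blockPairs.mpr (Or.inl ⟨hz₁, hx'⟩)) h0
  exact Finset.disjoint_left.mp hY hy₁ (hc.2.1 ▸ hy₂)

/-- `M'_111 ∩ M'_221 = ∅` (mirror): `y₁ - z₁ - x = y₂ - z₁' - w` is the accidental solution
`(w - y₂) + (y₁ - z₁) + (z₁' - x) = 0` and would force `y₁ = y₂`. -/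
theorem NoAccidental.disjoint_mixedImageNeg_111_221 (hY : Disjoint Y₁ Y₂)
    (hN : NoAccidental (id : G → G) id id (blockPairs X₁ Y₁ X₂ Y₂) (blockPairs Y₁ Z₁ Y₂ Z₂)
      (blockPairs Z₁ X₁ Z₂ X₂)) :
    Disjoint (mixedImageNeg X₁ Y₁ Z₁) (mixedImageNeg X₂ Y₂ Z₁) := by
  rw [Finset.disjoint_left]
  intro g hg1 hg2
  obtain ⟨x, hx, y₁, hy₁, z₁, hz₁, rfl⟩ := mem_mixedImageNeg.mp hg1
  obtain ⟨w, hw, y₂, hy₂, z₁', hz₁', heq⟩ := mem_mixedImageNeg.mp hg2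
  have h0 : (w - y₂) + (y₁ - z₁) + (z₁' - x) = 0 :=
    calc (w - y₂) + (y₁ - z₁) + (z₁' - x) = (y₁ - z₁ - x) - (y₂ - z₁' - w) := by abel
      _ = 0 := by rw [heq, sub_self]
  have hc := hN w y₂ y₁ z₁ z₁' x (mem_blockPairs.mpr (Or.inr ⟨hw, hy₂⟩))
    (mem_blockPairs.mpr (Or.inl ⟨hy₁, hz₁⟩)) (mem_blockPairs.mpr (Or.inl ⟨hz₁', hx⟩)) h0
  exact Finset.disjoint_left.mp hY hy₁ (hc.2.1.symm ▸ hy₂)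

/-- `M'_122 ∩ M'_221 = ∅` (mirror): `y₂ - z₂ - x = y₂' - z₁ - w` is the accidental solution
`(w - y₂') + (y₂ - z₂) + (z₁ - x) = 0` and would force `z₂ = z₁`. -/
theorem NoAccidental.disjoint_mixedImageNeg_122_221 (hZ : Disjoint Z₁ Z₂)
    (hN : NoAccidental (id : G → G) id id (blockPairs X₁ Y₁ X₂ Y₂) (blockPairs Y₁ Z₁ Y₂ Z₂)
      (blockPairs Z₁ X₁ Z₂ X₂)) :
    Disjoint (mixedImageNeg X₁ Y₂ Z₂) (mixedImageNeg X₂ Y₂ Z₁) := by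
  rw [Finset.disjoint_left]
  intro g hg1 hg2
  obtain ⟨x, hx, y₂, hy₂, z₂, hz₂, rfl⟩ := mem_mixedImageNeg.mp hg1
  obtain ⟨w, hw, y₂', hy₂', z₁, hz₁, heq⟩ := mem_mixedImageNeg.mp hg2
  have h0 : (w - y₂') + (y₂ - z₂) + (z₁ - x) = 0 :=
    calc (w - y₂') + (y₂ - z₂) + (z₁ - x) = (y₂ - z₂ - x) - (y₂' - z₁ - w) := by abel
      _ = 0 := by rw [heq, sub_self]
  have hc := hN w y₂' y₂ z₂ z₁ x (mem_blockPairs.mpr (Or.inr ⟨hw, hy₂'⟩))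
    (mem_blockPairs.mpr (Or.inr ⟨hy₂, hz₂⟩)) (mem_blockPairs.mpr (Or.inl ⟨hz₁, hx⟩)) h0
  exact Finset.disjoint_left.mp hZ hz₁ (hc.2.2.symm ▸ hz₂)

/-- THE MIXED-IMAGE INEQUALITY: `|X₁ + Y₁ - Z₁| + |X₁ + Y₂ - Z₂| + |X₂ + Y₁ - Z₂| ≤ |G|` for an accidental-free
pair of complete blocks with disjoint `J`- and `K`-classes (rows arbitrary). -/
theorem NoAccidental.card_mixedImages_le [Fintype G] (hY : Disjoint Y₁ Y₂) (hZ : Disjoint Z₁ Z₂)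
    (hN : NoAccidental (id : G → G) id id (blockPairs X₁ Y₁ X₂ Y₂) (blockPairs Y₁ Z₁ Y₂ Z₂)
      (blockPairs Z₁ X₁ Z₂ X₂)) :
    (mixedImage X₁ Y₁ Z₁).card + (mixedImage X₁ Y₂ Z₂).card + (mixedImage X₂ Y₁ Z₂).card
      ≤ Fintype.card G := by
  rw [← Finset.card_union_of_disjoint (hN.disjoint_mixedImage_111_122 hY),
    ← Finset.card_union_of_disjoint (Finset.disjoint_union_left.mpr
      ⟨hN.disjoint_mixedImage_111_212 hZ, hN.disjoint_mixedImage_122_212 hY⟩)]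
  exact Finset.card_le_univ _

/-- THE MIRRORED MIXED-IMAGE INEQUALITY: `|Y₁ - Z₁ - X₁| + |Y₂ - Z₂ - X₁| + |Y₂ - Z₁ - X₂| ≤ |G|`. -/
theorem NoAccidental.card_mixedImagesNeg_le [Fintype G] (hY : Disjoint Y₁ Y₂) (hZ : Disjoint Z₁ Z₂)
    (hN : NoAccidental (id : G → G) id id (blockPairs X₁ Y₁ X₂ Y₂) (blockPairs Y₁ Z₁ Y₂ Z₂)
      (blockPairs Z₁ X₁ Z₂ X₂)) :
    (mixedImageNeg X₁ Y₁ Z₁).card + (mixedImageNeg X₁ Y₂ Z₂).card + (mixedImageNeg X₂ Y₂ Z₁).card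
      ≤ Fintype.card G := by
  rw [← Finset.card_union_of_disjoint (hN.disjoint_mixedImageNeg_111_122 hY),
    ← Finset.card_union_of_disjoint (Finset.disjoint_union_left.mpr
      ⟨hN.disjoint_mixedImageNeg_111_221 hY, hN.disjoint_mixedImageNeg_122_221 hZ⟩)]
  exact Finset.card_le_univ _

/-- Block 1 is a TPP block: `|X₁ + Y₁ - Z₁| = |X₁||Y₁||Z₁|`. -/
theorem NoAccidental.card_mixedImage_block
    (hN : NoAccidental (id : G → G) id id (blockPairs X₁ Y₁ X₂ Y₂) (blockPairs Y₁ Z₁ Y₂ Z₂)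
      (blockPairs Z₁ X₁ Z₂ X₂)) :
    (mixedImage X₁ Y₁ Z₁).card = X₁.card * Y₁.card * Z₁.card := by
  have hinj : Set.InjOn (fun t : G × G × G => t.1 + t.2.1 - t.2.2) ↑(X₁ ×ˢ Y₁ ×ˢ Z₁) := by
    rintro ⟨x, y, z⟩ hm ⟨x', y', z'⟩ hm' heq
    simp only [Finset.coe_product, Set.mem_prod, Finset.mem_coe] at hm hm'
    have heq' : x + y - z = x' + y' - z' := heq
    have h0 : (x - y') + (y - z) + (z' - x') = 0 :=
      calc (x - y') + (y - z) + (z' - x') = (x + y - z) - (x' + y' - z') := by abel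
        _ = 0 := by rw [heq', sub_self]
    obtain ⟨hx, hy, hz⟩ := hN x y' y z z' x' (mem_blockPairs.mpr (Or.inl ⟨hm.1, hm'.2.1⟩))
      (mem_blockPairs.mpr (Or.inl ⟨hm.2.1, hm.2.2⟩)) (mem_blockPairs.mpr (Or.inl ⟨hm'.2.2, hm'.1⟩)) h0
    rw [hx, ← hy, hz]
  unfold mixedImage
  rw [Finset.card_image_of_injOn hinj, Finset.card_product, Finset.card_product, Nat.mul_assoc]

/-- Block 1 is a TPP block, mirrored: `|Y₁ - Z₁ - X₁| = |X₁||Y₁||Z₁|`. -/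
theorem NoAccidental.card_mixedImageNeg_block
    (hN : NoAccidental (id : G → G) id id (blockPairs X₁ Y₁ X₂ Y₂) (blockPairs Y₁ Z₁ Y₂ Z₂)
      (blockPairs Z₁ X₁ Z₂ X₂)) :
    (mixedImageNeg X₁ Y₁ Z₁).card = X₁.card * Y₁.card * Z₁.card := by
  have hinj : Set.InjOn (fun t : G × G × G => t.2.1 - t.2.2 - t.1) ↑(X₁ ×ˢ Y₁ ×ˢ Z₁) := by
    rintro ⟨x, y, z⟩ hm ⟨x', y', z'⟩ hm' heq
    simp only [Finset.coe_product, Set.mem_prod, Finset.mem_coe] at hm hm'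
    have heq' : y - z - x = y' - z' - x' := heq
    have h0 : (x' - y') + (y - z) + (z' - x) = 0 :=
      calc (x' - y') + (y - z) + (z' - x) = (y - z - x) - (y' - z' - x') := by abel
        _ = 0 := by rw [heq', sub_self]
    obtain ⟨hx, hy, hz⟩ := hN x' y' y z z' x (mem_blockPairs.mpr (Or.inl ⟨hm'.1, hm'.2.1⟩))
      (mem_blockPairs.mpr (Or.inl ⟨hm.2.1, hm.2.2⟩)) (mem_blockPairs.mpr (Or.inl ⟨hm'.2.2, hm.1⟩)) h0
    rw [hx, ← hy, hz]
  unfold mixedImageNeg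
  rw [Finset.card_image_of_injOn hinj, Finset.card_product, Finset.card_product, Nat.mul_assoc]

/-- `|X₁ + Y₂ - Z₂| ≥ |Y₂||Z₂|`: the mixed image contains a translate of `Y₂ - Z₂`, which is uniquely represented
(block 2 is a TPP block; `X₁`, `X₂` non-empty). -/
theorem NoAccidental.card_YZ_le_card_mixedImage (hX₁ : X₁.Nonempty) (hX₂ : X₂.Nonempty)
    (hN : NoAccidental (id : G → G) id id (blockPairs X₁ Y₁ X₂ Y₂) (blockPairs Y₁ Z₁ Y₂ Z₂)
      (blockPairs Z₁ X₁ Z₂ X₂)) :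
    Y₂.card * Z₂.card ≤ (mixedImage X₁ Y₂ Z₂).card := by
  obtain ⟨x₁, hx₁⟩ := hX₁
  obtain ⟨x₂, hx₂⟩ := hX₂
  have hinj : Set.InjOn (fun p : G × G => x₁ + p.1 - p.2) ↑(Y₂ ×ˢ Z₂) := by
    rintro ⟨y, z⟩ hm ⟨y', z'⟩ hm' heq
    simp only [Finset.coe_product, Set.mem_prod, Finset.mem_coe] at hm hm'
    have heq' : x₁ + y - z = x₁ + y' - z' := heq
    have h0 : (x₂ - y') + (y - z) + (z' - x₂) = 0 :=
      calc (x₂ - y') + (y - z) + (z' - x₂) = (x₁ + y - z) - (x₁ + y' - z') := by abel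
        _ = 0 := by rw [heq', sub_self]
    obtain ⟨-, hy, hz⟩ := hN x₂ y' y z z' x₂ (mem_blockPairs.mpr (Or.inr ⟨hx₂, hm'.1⟩))
      (mem_blockPairs.mpr (Or.inr ⟨hm.1, hm.2⟩)) (mem_blockPairs.mpr (Or.inr ⟨hm'.2, hx₂⟩)) h0
    rw [← hy, hz]
  have hsub : (Y₂ ×ˢ Z₂).image (fun p : G × G => x₁ + p.1 - p.2) ⊆ mixedImage X₁ Y₂ Z₂ := by
    intro g hg
    obtain ⟨⟨y, z⟩, hm, rfl⟩ := Finset.mem_image.mp hg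
    rw [Finset.mem_product] at hm
    exact mem_mixedImage.mpr ⟨x₁, hx₁, y, hm.1, z, hm.2, rfl⟩
  calc Y₂.card * Z₂.card = ((Y₂ ×ˢ Z₂).image (fun p : G × G => x₁ + p.1 - p.2)).card := by
        rw [Finset.card_image_of_injOn hinj, Finset.card_product]
    _ ≤ (mixedImage X₁ Y₂ Z₂).card := Finset.card_le_card hsub

/-- `|X₂ + Y₁ - Z₂| ≥ |X₂||Z₂|`: the mixed image contains a translate of `X₂ - Z₂`, which is uniquely represented
(block 2 is a TPP block; `Y₁`, `Y₂` non-empty). -/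
theorem NoAccidental.card_XZ_le_card_mixedImage (hY₁ : Y₁.Nonempty) (hY₂ : Y₂.Nonempty)
    (hN : NoAccidental (id : G → G) id id (blockPairs X₁ Y₁ X₂ Y₂) (blockPairs Y₁ Z₁ Y₂ Z₂)
      (blockPairs Z₁ X₁ Z₂ X₂)) :
    X₂.card * Z₂.card ≤ (mixedImage X₂ Y₁ Z₂).card := by
  obtain ⟨y₀, hy₀⟩ := hY₁
  obtain ⟨yt, hyt⟩ := hY₂
  have hinj : Set.InjOn (fun p : G × G => p.1 + y₀ - p.2) ↑(X₂ ×ˢ Z₂) := by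
    rintro ⟨x, z⟩ hm ⟨x', z'⟩ hm' heq
    simp only [Finset.coe_product, Set.mem_prod, Finset.mem_coe] at hm hm'
    have heq' : x + y₀ - z = x' + y₀ - z' := heq
    have h0 : (x - yt) + (yt - z) + (z' - x') = 0 :=
      calc (x - yt) + (yt - z) + (z' - x') = (x + y₀ - z) - (x' + y₀ - z') := by abel
        _ = 0 := by rw [heq', sub_self]
    obtain ⟨hx, -, hz⟩ := hN x yt yt z z' x' (mem_blockPairs.mpr (Or.inr ⟨hm.1, hyt⟩))
      (mem_blockPairs.mpr (Or.inr ⟨hyt, hm.2⟩)) (mem_blockPairs.mpr (Or.inr ⟨hm'.2, hm'.1⟩)) h0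
    rw [hx, hz]
  have hsub : (X₂ ×ˢ Z₂).image (fun p : G × G => p.1 + y₀ - p.2) ⊆ mixedImage X₂ Y₁ Z₂ := by
    intro g hg
    obtain ⟨⟨x, z⟩, hm, rfl⟩ := Finset.mem_image.mp hg
    rw [Finset.mem_product] at hm
    exact mem_mixedImage.mpr ⟨x, hm.1, y₀, hy₀, z, hm.2, rfl⟩
  calc X₂.card * Z₂.card = ((X₂ ×ˢ Z₂).image (fun p : G × G => p.1 + y₀ - p.2)).card := by
        rw [Finset.card_image_of_injOn hinj, Finset.card_product]
    _ ≤ (mixedImage X₂ Y₁ Z₂).card := Finset.card_le_card hsub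

/-- `|Y₂ - Z₂ - X₁| ≥ |Y₂||Z₂|` (mirror; `X₁`, `X₂` non-empty). -/
theorem NoAccidental.card_YZ_le_card_mixedImageNeg (hX₁ : X₁.Nonempty) (hX₂ : X₂.Nonempty)
    (hN : NoAccidental (id : G → G) id id (blockPairs X₁ Y₁ X₂ Y₂) (blockPairs Y₁ Z₁ Y₂ Z₂)
      (blockPairs Z₁ X₁ Z₂ X₂)) :
    Y₂.card * Z₂.card ≤ (mixedImageNeg X₁ Y₂ Z₂).card := by
  obtain ⟨x₁, hx₁⟩ := hX₁
  obtain ⟨x₂, hx₂⟩ := hX₂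
  have hinj : Set.InjOn (fun p : G × G => p.1 - p.2 - x₁) ↑(Y₂ ×ˢ Z₂) := by
    rintro ⟨y, z⟩ hm ⟨y', z'⟩ hm' heq
    simp only [Finset.coe_product, Set.mem_prod, Finset.mem_coe] at hm hm'
    have heq' : y - z - x₁ = y' - z' - x₁ := heq
    have h0 : (x₂ - y') + (y - z) + (z' - x₂) = 0 :=
      calc (x₂ - y') + (y - z) + (z' - x₂) = (y - z - x₁) - (y' - z' - x₁) := by abel
        _ = 0 := by rw [heq', sub_self]
    obtain ⟨-, hy, hz⟩ := hN x₂ y' y z z' x₂ (mem_blockPairs.mpr (Or.inr ⟨hx₂, hm'.1⟩))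
      (mem_blockPairs.mpr (Or.inr ⟨hm.1, hm.2⟩)) (mem_blockPairs.mpr (Or.inr ⟨hm'.2, hx₂⟩)) h0
    rw [← hy, hz]
  have hsub : (Y₂ ×ˢ Z₂).image (fun p : G × G => p.1 - p.2 - x₁) ⊆ mixedImageNeg X₁ Y₂ Z₂ := by
    intro g hg
    obtain ⟨⟨y, z⟩, hm, rfl⟩ := Finset.mem_image.mp hg
    rw [Finset.mem_product] at hm
    exact mem_mixedImageNeg.mpr ⟨x₁, hx₁, y, hm.1, z, hm.2, rfl⟩
  calc Y₂.card * Z₂.card = ((Y₂ ×ˢ Z₂).image (fun p : G × G => p.1 - p.2 - x₁)).card := by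
        rw [Finset.card_image_of_injOn hinj, Finset.card_product]
    _ ≤ (mixedImageNeg X₁ Y₂ Z₂).card := Finset.card_le_card hsub

/-- `|Y₂ - Z₁ - X₂| ≥ |X₂||Y₂|`: the mirrored mixed image contains `Y₂ - z₁ - X₂`, uniquely represented (block 2 is
a TPP block; `Z₁`, `Z₂` non-empty). -/
theorem NoAccidental.card_XY_le_card_mixedImageNeg (hZ₁ : Z₁.Nonempty) (hZ₂ : Z₂.Nonempty)
    (hN : NoAccidental (id : G → G) id id (blockPairs X₁ Y₁ X₂ Y₂) (blockPairs Y₁ Z₁ Y₂ Z₂)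
      (blockPairs Z₁ X₁ Z₂ X₂)) :
    X₂.card * Y₂.card ≤ (mixedImageNeg X₂ Y₂ Z₁).card := by
  obtain ⟨z₁, hz₁⟩ := hZ₁
  obtain ⟨zt, hzt⟩ := hZ₂
  have hinj : Set.InjOn (fun p : G × G => p.2 - z₁ - p.1) ↑(X₂ ×ˢ Y₂) := by
    rintro ⟨x, y⟩ hm ⟨x', y'⟩ hm' heq
    simp only [Finset.coe_product, Set.mem_prod, Finset.mem_coe] at hm hm'
    have heq' : y - z₁ - x = y' - z₁ - x' := heq
    have h0 : (x' - y') + (y - zt) + (zt - x) = 0 :=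
      calc (x' - y') + (y - zt) + (zt - x) = (y - z₁ - x) - (y' - z₁ - x') := by abel
        _ = 0 := by rw [heq', sub_self]
    obtain ⟨hx, hy, -⟩ := hN x' y' y zt zt x (mem_blockPairs.mpr (Or.inr ⟨hm'.1, hm'.2⟩))
      (mem_blockPairs.mpr (Or.inr ⟨hm.2, hzt⟩)) (mem_blockPairs.mpr (Or.inr ⟨hzt, hm.1⟩)) h0
    rw [hx, hy]
  have hsub : (X₂ ×ˢ Y₂).image (fun p : G × G => p.2 - z₁ - p.1) ⊆ mixedImageNeg X₂ Y₂ Z₁ := by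
    intro g hg
    obtain ⟨⟨x, y⟩, hm, rfl⟩ := Finset.mem_image.mp hg
    rw [Finset.mem_product] at hm
    exact mem_mixedImageNeg.mpr ⟨x, hm.1, y, hm.2, z₁, hz₁, rfl⟩
  calc X₂.card * Y₂.card = ((X₂ ×ˢ Y₂).image (fun p : G × G => p.2 - z₁ - p.1)).card := by
        rw [Finset.card_image_of_injOn hinj, Finset.card_product]
    _ ≤ (mixedImageNeg X₂ Y₂ Z₁).card := Finset.card_le_card hsub

/-- FIRST FACE INEQUALITY WITHOUT A HUB: `|X₁||Y₁||Z₁| + |Y₂||Z₂| + |X₂||Z₂| ≤ |G|` for any accidental-free pair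
of complete blocks with disjoint `J`- and `K`-classes and non-empty `X₁, X₂, Y₁, Y₂` (generalises
`NoAccidental.volume_add_faces_YZ_XZ_le`, which assumed a common row). -/
theorem NoAccidental.volume_add_faces_YZ_XZ_le_of_disjoint [Fintype G]
    (hX₁ : X₁.Nonempty) (hX₂ : X₂.Nonempty) (hY₁ : Y₁.Nonempty) (hY₂ : Y₂.Nonempty)
    (hY : Disjoint Y₁ Y₂) (hZ : Disjoint Z₁ Z₂)
    (hN : NoAccidental (id : G → G) id id (blockPairs X₁ Y₁ X₂ Y₂) (blockPairs Y₁ Z₁ Y₂ Z₂)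
      (blockPairs Z₁ X₁ Z₂ X₂)) :
    X₁.card * Y₁.card * Z₁.card + Y₂.card * Z₂.card + X₂.card * Z₂.card ≤ Fintype.card G :=
  calc X₁.card * Y₁.card * Z₁.card + Y₂.card * Z₂.card + X₂.card * Z₂.card
      ≤ (mixedImage X₁ Y₁ Z₁).card + (mixedImage X₁ Y₂ Z₂).card + (mixedImage X₂ Y₁ Z₂).card := by
        rw [hN.card_mixedImage_block]
        exact Nat.add_le_add (Nat.add_le_add_left (hN.card_YZ_le_card_mixedImage hX₁ hX₂) _)
          (hN.card_XZ_le_card_mixedImage hY₁ hY₂)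
    _ ≤ Fintype.card G := hN.card_mixedImages_le hY hZ

/-- SECOND FACE INEQUALITY WITHOUT A HUB: `|X₁||Y₁||Z₁| + |Y₂||Z₂| + |X₂||Y₂| ≤ |G|` (non-empty
`X₁, X₂, Z₁, Z₂`; generalises `NoAccidental.volume_add_faces_YZ_XY_le`). -/
theorem NoAccidental.volume_add_faces_YZ_XY_le_of_disjoint [Fintype G]
    (hX₁ : X₁.Nonempty) (hX₂ : X₂.Nonempty) (hZ₁ : Z₁.Nonempty) (hZ₂ : Z₂.Nonempty)
    (hY : Disjoint Y₁ Y₂) (hZ : Disjoint Z₁ Z₂)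
    (hN : NoAccidental (id : G → G) id id (blockPairs X₁ Y₁ X₂ Y₂) (blockPairs Y₁ Z₁ Y₂ Z₂)
      (blockPairs Z₁ X₁ Z₂ X₂)) :
    X₁.card * Y₁.card * Z₁.card + Y₂.card * Z₂.card + X₂.card * Y₂.card ≤ Fintype.card G :=
  calc X₁.card * Y₁.card * Z₁.card + Y₂.card * Z₂.card + X₂.card * Y₂.card
      ≤ (mixedImageNeg X₁ Y₁ Z₁).card + (mixedImageNeg X₁ Y₂ Z₂).card
          + (mixedImageNeg X₂ Y₂ Z₁).card := by
        rw [hN.card_mixedImageNeg_block]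
        exact Nat.add_le_add (Nat.add_le_add_left (hN.card_YZ_le_card_mixedImageNeg hX₁ hX₂) _)
          (hN.card_XY_le_card_mixedImageNeg hZ₁ hZ₂)
    _ ≤ Fintype.card G := hN.card_mixedImagesNeg_le hY hZ

/-- CONSEQUENCE FOR THE TOTAL VOLUME (no hub): with all classes non-empty,
`v₁ + v₂ + |X₂| max(|Y₂|, |Z₂|) ≤ |G| + (|X₂| - 1)|Y₂||Z₂|`, written additively. -/
theorem NoAccidental.volume_add_volume_le_of_disjoint [Fintype G]
    (hX₁ : X₁.Nonempty) (hX₂ : X₂.Nonempty) (hY₁ : Y₁.Nonempty) (hY₂ : Y₂.Nonempty)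
    (hZ₁ : Z₁.Nonempty) (hZ₂ : Z₂.Nonempty) (hY : Disjoint Y₁ Y₂) (hZ : Disjoint Z₁ Z₂)
    (hN : NoAccidental (id : G → G) id id (blockPairs X₁ Y₁ X₂ Y₂) (blockPairs Y₁ Z₁ Y₂ Z₂)
      (blockPairs Z₁ X₁ Z₂ X₂)) :
    X₁.card * Y₁.card * Z₁.card + X₂.card * Y₂.card * Z₂.card
        + X₂.card * max Y₂.card Z₂.card + Y₂.card * Z₂.card
      ≤ Fintype.card G + X₂.card * Y₂.card * Z₂.card := by
  have h1 := hN.volume_add_faces_YZ_XZ_le_of_disjoint hX₁ hX₂ hY₁ hY₂ hY hZ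
  have h2 := hN.volume_add_faces_YZ_XY_le_of_disjoint hX₁ hX₂ hZ₁ hZ₂ hY hZ
  rcases le_total Y₂.card Z₂.card with hle | hle
  · rw [max_eq_right hle]; omega
  · rw [max_eq_left hle]; omega

end MixedImages
end Summit.MatrixMultiplication.MatrixMultiplication.Theorems.SoloVal
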